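import Summits.Schanuel.Schanuel.Theorems.RootDecomp1BMovingZero18

/-!
# RootDecomp1BMovingZero — lens 4, generation 39 «ISOLATED POINT BOUND, SLOT DISCHARGED» (lane B-R24 (a) / RULE B-R25): the last B-side print input `IsolatedPointBound` (FACT B, part 11) of the moving-zero cell DISCHARGED up to its parameter-free numeral — `def IsolatedPointBoundN` (part 11's text with `(2n+3)·log(n+1) ↦ 6n³`) and `theorem isolatedPointBoundN_holds : IsolatedPointBoundN` HYPOTHESIS-FREE from the tree's proved Nesterenko–Philippon elimination theory; `ApproxOfIsolated ρ` UNCONDITIONAL for every real ρ; `MovingZeroApprox ρ` modulo `AxRankBoundLaurent` only; the (1|ρ) storey cell modulo {Ax, LWMeasure, ExplicitRatExpApprox} — continuation (RootDecomp1BMovingZero19): §E4a the u-resultant on the lines τ e₀ − e_{j+1}: defs and coefficient / degree lemmas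

(lens-4 g39 HOME kernel IsolatedPointDischarge.lean dce96aa4…, 1262 l, imports tree MovingZero17 + the Literature elimination theory (PhilipponCriterionDescend / ProjectiveNoIsolatedPoints / NesterenkoEliminationProp411Holds / Prop47Holds / Facts2Proofs / NesterenkoUResultantIntCoeffs / NesterenkoIntegerHeights / PhilipponCriterionRankOne / ConeRank / Principal / NesterenkoEliminationZeros) + Mathlib MahlerMeasure; CLAIM L2051, RULING + RULE B-R25 + CHECKLIST B-g39 L2053, NODE L2060 / REQUEST L2061 / RESULT L2062, critic VERDICT L2063 (crit g8: CLEARED — THEOREM ×1 for the SLOT under RULE B-R25; lens-4 tally THEOREM ×6 + CELL ×2; the moving-zero cell's named inputs of record = {AxRankBoundLaurent, LWMeasure, ExplicitRatExpApprox}; PORT GO); port by census-1 gen 18 as `RootDecomp1BMovingZero18`–`22`: 18 = `namespace IsolatedPt` §E1–§E3 (binary forms at `(1,t)`, algebraicity of the coordinates on a rank-one prime, no point at infinity); 19 = §E4a the `u`-resultant read on the lines `τ e₀ − e_{j+1}` (`zpart` / `gPoly` / `uVec` / `pairExp`, coefficient and degree lemmas); 20 = §E4b the rank-one endgame `IsolatedPt.exists_poly_of_rank_one`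 (integer Chow form + Mahler measure) + §D the TRACKED DESCENT `IsolatedPt.descent_tracked` + §A arithmetic (`log_mvPolyHeight_le`, `junk_absorb`, `sharp_le_junk`); 21 = §N `def IsolatedPointBoundN`, (γ) `isolatedPointBoundN_of_isolatedPointBound`, THE DISCHARGE `isolatedPointBoundN_holds` (kind definition, `--no-relocate`); 22 = §B consumers re-run (`isolatedPointBoundN_five`, `height_side_leN`, `approxOfIsolated_of_factsN`, `movingZeroApprox_of_factsN`, `approxOfIsolated_holds`, `approxOfIsolated_of_ax`, `movingZeroApprox_of_ax`) + the four cells `four_le_polarDeg_one/swap/one_hyper/one_rhoT_of_ax`.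
PORT EDITS: the `AxiomGuards` section (7 `#guard_msgs in #print axioms`), the unused `import HarnessLib` and `set_option linter.dupNamespace false` dropped; eleven one-line docstrings added; statements and proofs verbatim. `--supports stmt-Schanuel-24622`; no census credit carried; rung 0 — nothing here proves Schanuel.)
-/

noncomputable section

attribute [local instance] MvPolynomial.gradedAlgebra

open MvPolynomial
open Literature.NumberTheory.Transcendental
open Literature.NumberTheory.Transcendental.Nesterenko
open Literature.NumberTheory.Transcendental.PhilipponMain

namespace Summit.Schanuel.Schanuel.Theorems.RootDecomp1BMovingZero

namespace IsolatedPt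

/-! ## §E4  The `u`-resultant of a rank-one prime, read on the lines `τ e₀ − e_{j+1}` -/

section URes

variable {m : ℕ}

/-- The sign pattern `∏ₖ (−δ_{kj})^{γ(0,k+1)}`: `(−1)^{γ(0,j+1)}` if `γ` is supported on
`{(0,0), (0,j+1)}`, else `0`. -/
def zpart (j : Fin m) (γ : Fin 1 × Fin (m + 1) →₀ ℕ) : ℤ :=
  ∏ k : Fin m, (if k = j then (-1 : ℤ) else 0) ^ γ (0, k.succ)

/-- The integer polynomial `g_j(T) = F₀(T e₀ − e_{j+1})`. -/
def gPoly (F₀ : RUZ 1 m) (j : Fin m) : Polynomial ℤ :=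
  ∑ γ ∈ F₀.support, Polynomial.monomial (γ (0, 0)) (coeff γ F₀ * zpart j γ)

/-- The vector `u_j(τ) = τ e₀ − e_{j+1}` (one row, `r = 1`). -/
def uVec (j : Fin m) (τ : ℂ) : Fin 1 × Fin (m + 1) → ℂ :=
  fun v => (Fin.cons τ (Pi.single j (-1 : ℂ)) : Fin (m + 1) → ℂ) v.2

/-- The sign pattern `zpart j γ` has absolute value `≤ 1`. -/
theorem abs_zpart_le_one (j : Fin m) (γ : Fin 1 × Fin (m + 1) →₀ ℕ) : |zpart j γ| ≤ 1 := by
  unfold zpart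
  rw [Finset.abs_prod]
  refine Finset.prod_le_one (fun k _ => abs_nonneg _) fun k _ => ?_
  rw [abs_pow]
  refine pow_le_one₀ (abs_nonneg _) ?_
  split_ifs <;> simp

/-- If `zpart j γ ≠ 0` then `γ` vanishes at every `(0, k+1)` with `k ≠ j`. -/
theorem zpart_ne_zero_imp {j : Fin m} {γ : Fin 1 × Fin (m + 1) →₀ ℕ} (h : zpart j γ ≠ 0)
    {k : Fin m} (hk : k ≠ j) : γ (0, k.succ) = 0 := by
  classical
  unfold zpart at h
  rw [Finset.prod_ne_zero_iff] at h
  have hk' := h k (Finset.mem_univ k)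
  rw [if_neg hk] at hk'
  by_contra hne
  exact hk' (zero_pow hne)

/-- `zpart j (D · (0,0)) = 1`. -/
theorem zpart_single_zero (j : Fin m) (D : ℕ) :
    zpart j (Finsupp.single ((0 : Fin 1), (0 : Fin (m + 1))) D) = 1 := by
  classical
  unfold zpart
  refine Finset.prod_eq_one fun k _ => ?_
  have h0 : (Finsupp.single ((0 : Fin 1), (0 : Fin (m + 1))) D) (0, k.succ) = 0 := by
    rw [Finsupp.single_apply, if_neg]
    intro h
    exact Fin.succ_ne_zero k (Prod.mk.inj h).2.symm
  rw [h0, pow_zero]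

/-- Expansion of an integer form at a complex point. -/
theorem aeval_eq_sum_support (F₀ : RUZ 1 m) (u : Fin 1 × Fin (m + 1) → ℂ) :
    aeval u F₀ = ∑ γ ∈ F₀.support, ((coeff γ F₀ : ℤ) : ℂ) * ∏ v, u v ^ γ v := by
  classical
  conv_lhs => rw [F₀.as_sum]
  rw [map_sum]
  refine Finset.sum_congr rfl fun γ _ => ?_
  rw [aeval_monomial, Finsupp.prod_fintype _ _ (fun v => by simp)]
  simp

/-- The monomial `γ` evaluated at `u_j(τ) = τ e₀ − e_{j+1}` is `τ ^ γ(0,0) · zpart j γ`. -/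
theorem prod_uVec_pow (j : Fin m) (τ : ℂ) (γ : Fin 1 × Fin (m + 1) →₀ ℕ) :
    ∏ v, uVec j τ v ^ γ v = τ ^ γ (0, 0) * (zpart j γ : ℂ) := by
  classical
  rw [Fintype.prod_prod_type, Fin.prod_univ_one, Fin.prod_univ_succ]
  simp only [uVec, Fin.cons_zero, Fin.cons_succ, Pi.single_apply, zpart]
  push_cast
  rfl

/-- `F₀(u_j(τ)) = g_j(τ)`. -/
theorem aeval_uVec (F₀ : RUZ 1 m) (j : Fin m) (τ : ℂ) :
    aeval (uVec j τ) F₀ = Polynomial.aeval τ (gPoly F₀ j) := by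
  classical
  rw [aeval_eq_sum_support, gPoly, map_sum]
  refine Finset.sum_congr rfl fun γ _ => ?_
  rw [prod_uVec_pow, Polynomial.aeval_monomial]
  simp only [map_mul, eq_intCast]
  ring

/-- The coefficient of `T ^ a` in `g_j(T) = F₀(T e₀ − e_{j+1})`. -/
theorem coeff_gPoly (F₀ : RUZ 1 m) (j : Fin m) (a : ℕ) :
    (gPoly F₀ j).coeff a =
      ∑ γ ∈ F₀.support, if γ (0, 0) = a then coeff γ F₀ * zpart j γ else 0 := by
  classical
  simp only [gPoly, Polynomial.finsetSum_coeff, Polynomial.coeff_monomial]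

/-- At the point `e₀`: only the exponent `D·(0,0)` survives. -/
theorem prod_e0_pow (γ : Fin 1 × Fin (m + 1) →₀ ℕ) :
    ∏ v, (Fin.cons 1 (0 : Fin m → ℂ) : Fin (m + 1) → ℂ) v.2 ^ γ v =
      if ∀ k : Fin m, γ (0, k.succ) = 0 then 1 else 0 := by
  classical
  rw [Fintype.prod_prod_type, Fin.prod_univ_one, Fin.prod_univ_succ]
  simp only [Fin.cons_zero, Fin.cons_succ, Pi.zero_apply, one_pow, one_mul]
  split_ifs with h
  · exact Finset.prod_eq_one fun k _ => by rw [h k, pow_zero]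
  · push Not at h
    obtain ⟨k, hk⟩ := h
    exact Finset.prod_eq_zero (Finset.mem_univ k) (zero_pow hk)

/-- Total degree of an exponent with one row, split at the coordinate `0`. -/
theorem sum_eq_zero_add (γ : Fin 1 × Fin (m + 1) →₀ ℕ) :
    ∑ v, γ v = γ (0, 0) + ∑ k : Fin m, γ (0, k.succ) := by
  rw [Fintype.sum_prod_type, Fin.sum_univ_one, Fin.sum_univ_succ]

/-- An exponent of total degree `D` supported on `{(0,0)}` is `D·(0,0)`. -/
theorem eq_single_of_forall {γ : Fin 1 × Fin (m + 1) →₀ ℕ} {D : ℕ} (hdeg : ∑ v, γ v = D)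
    (h : ∀ k : Fin m, γ (0, k.succ) = 0) :
    γ = Finsupp.single ((0 : Fin 1), (0 : Fin (m + 1))) D := by
  classical
  rw [sum_eq_zero_add, Finset.sum_eq_zero (fun k _ => h k), add_zero] at hdeg
  ext ⟨a, b⟩
  have ha : a = 0 := Fin.fin_one_eq_zero a
  subst ha
  refine Fin.cases ?_ (fun k => ?_) b
  · rw [hdeg, Finsupp.single_eq_same]
  · rw [h k, Finsupp.single_apply, if_neg]
    intro h'
    exact Fin.succ_ne_zero k (Prod.mk.inj h').2.symm

/-- An exponent of total degree `D` supported on `{(0,0), (0,j+1)}` is determined by `γ(0,0)`. -/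
theorem eq_pair_of_forall {γ : Fin 1 × Fin (m + 1) →₀ ℕ} {D : ℕ} (hdeg : ∑ v, γ v = D)
    {j : Fin m} (h : ∀ k : Fin m, k ≠ j → γ (0, k.succ) = 0) :
    γ = Finsupp.single ((0 : Fin 1), (0 : Fin (m + 1))) (γ (0, 0)) +
      Finsupp.single ((0 : Fin 1), j.succ) (D - γ (0, 0)) := by
  classical
  rw [sum_eq_zero_add, Finset.sum_eq_single j (fun k _ hk => h k hk) (fun hj => absurd
    (Finset.mem_univ j) hj)] at hdeg
  ext ⟨a, b⟩
  have ha : a = 0 := Fin.fin_one_eq_zero a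
  subst ha
  refine Fin.cases ?_ (fun k => ?_) b
  · rw [Finsupp.add_apply, Finsupp.single_eq_same, Finsupp.single_apply, if_neg, add_zero]
    intro h'
    exact Fin.succ_ne_zero j (Prod.mk.inj h').2
  · rw [Finsupp.add_apply, Finsupp.single_apply, if_neg (fun h' => Fin.succ_ne_zero k
      (Prod.mk.inj h').2.symm), zero_add, Finsupp.single_apply]
    by_cases hk : k = j
    · subst hk
      rw [if_pos rfl]
      omega
    · rw [h k hk, if_neg]
      intro h'
      exact hk (Fin.succ_injective _ (Prod.mk.inj h').2).symm

/-- The exponent `a·(0,0) + (D−a)·(0,j+1)`. -/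
def pairExp (j : Fin m) (D a : ℕ) : Fin 1 × Fin (m + 1) →₀ ℕ :=
  Finsupp.single ((0 : Fin 1), (0 : Fin (m + 1))) a + Finsupp.single ((0 : Fin 1), j.succ) (D - a)

/-- `pairExp j D a (0, 0) = a`. -/
theorem pairExp_zero (j : Fin m) (D a : ℕ) : pairExp j D a (0, 0) = a := by
  classical
  rw [pairExp, Finsupp.add_apply, Finsupp.single_eq_same, Finsupp.single_apply, if_neg, add_zero]
  intro h'
  exact Fin.succ_ne_zero j (Prod.mk.inj h').2

/-- Under homogeneity of degree `D`, the coefficient `a` of `g_j` is a single coefficient of `F₀`. -/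
theorem coeff_gPoly_eq (F₀ : RUZ 1 m) (j : Fin m) {D : ℕ}
    (hdeg : ∀ γ ∈ F₀.support, ∑ v, γ v = D) (a : ℕ) :
    (gPoly F₀ j).coeff a = coeff (pairExp j D a) F₀ * zpart j (pairExp j D a) := by
  classical
  rw [coeff_gPoly, Finset.sum_eq_single (pairExp j D a)]
  · rw [if_pos (pairExp_zero j D a)]
  · intro γ hγ hne
    by_cases ha : γ (0, 0) = a
    · rw [if_pos ha]
      by_cases hz : zpart j γ = 0
      · rw [hz, mul_zero]
      · exfalso
        apply hne
        have := eq_pair_of_forall (hdeg γ hγ) (fun k hk => zpart_ne_zero_imp hz hk)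
        rw [this, pairExp, ha]
    · rw [if_neg ha]
  · intro hmem
    rw [if_pos (pairExp_zero j D a), notMem_support_iff.mp hmem, zero_mul]

/-- `natDegree (g_j) ≤ D` when `F₀` is supported in total degree `D`. -/
theorem natDegree_gPoly_le (F₀ : RUZ 1 m) (j : Fin m) {D : ℕ}
    (hdeg : ∀ γ ∈ F₀.support, ∑ v, γ v = D) : (gPoly F₀ j).natDegree ≤ D := by
  classical
  rw [Polynomial.natDegree_le_iff_coeff_eq_zero]
  intro a ha
  rw [coeff_gPoly]
  refine Finset.sum_eq_zero fun γ hγ => ?_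
  rw [if_neg]
  intro h
  have hle : γ (0, 0) ≤ D := by
    rw [← hdeg γ hγ, sum_eq_zero_add]
    exact Nat.le_add_right _ _
  rw [h] at hle
  exact absurd hle (by exact_mod_cast not_le.mpr ha)

/-- `F₀(e₀)` is the coefficient of `x_{(0,0)}^D`. -/
theorem aeval_e0_eq (F₀ : RUZ 1 m) {D : ℕ} (hdeg : ∀ γ ∈ F₀.support, ∑ v, γ v = D) :
    aeval (fun v : Fin 1 × Fin (m + 1) => (Fin.cons 1 (0 : Fin m → ℂ) : Fin (m + 1) → ℂ) v.2) F₀ =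
      ((coeff (Finsupp.single ((0 : Fin 1), (0 : Fin (m + 1))) D) F₀ : ℤ) : ℂ) := by
  classical
  rw [aeval_eq_sum_support, Finset.sum_eq_single (Finsupp.single ((0 : Fin 1), (0 : Fin (m + 1))) D)]
  · rw [prod_e0_pow, if_pos, mul_one]
    intro k
    rw [Finsupp.single_apply, if_neg]
    intro h'
    exact Fin.succ_ne_zero k (Prod.mk.inj h').2.symm
  · intro γ hγ hne
    rw [prod_e0_pow, if_neg, mul_zero]
    intro h
    exact hne (eq_single_of_forall (hdeg γ hγ) h)
  · intro hmem
    rw [notMem_support_iff.mp hmem, Int.cast_zero, zero_mul]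

end URes

end IsolatedPt

end Summit.Schanuel.Schanuel.Theorems.RootDecomp1BMovingZero

end
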